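import Summits.Ventures.WeilGRH.UniformConductorFloorGalerkinWitness
import HarnessLib

/-!
# GRH arm (rh-explicit, venture WeilGRH): the principal character mod `211` FAILS Weil positivity on `[-(log 11)/2, (log 11)/2]` — a table-free
  `16`-mode kernel Galerkin witness

Cell `rh-explicit`, WEIL TRACK — GRH ARM (weil-grh-1, gen9).  One of the razor moduli of the principal dichotomy at the window `(log 11)/2`
(`= (log 11)/2`): `q = 211` lies above the FLAT threshold of its coprimality pattern (primes of `210` dividing `q`: `[]`), so Yoshida's flat
window does not refute it, while the even Galerkin bottoms of its level pseudo-key form exceed `211` (float: bottom eigenvector of the `16`-mode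
section, form/‖c‖² = `-1.363e-02`).  The tool `UniformFloor.galerkinCheckHalfLog` / `not_weilPositivityOnChar_halfLog_of_galerkinCheck`
(`UniformConductorFloorGalerkinWitness.lean`, where the same is done for `38` at `(log 8)/2`) certifies the integer witness in the kernel with no
special-value table (records of the modes `0 … 16` by `Encl.idxRec` inside the `decide`; evaluator `⟨2^80, 64, 8, 16, 40⟩`).
RH/GRH-free (principal characters carry no polar term by the tree's convention); no definitions; standard axioms.

## References

* H. Yoshida, *On Hermitian forms attached to zeta functions*, Adv. Stud. Pure Math. 21 (1992) 281–325, §3, §5 (5.15)/(5.16) p. 301.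
  [Yoshida1992HermitianForms]
* R. E. Moore, *Interval Analysis* (1966), Ch. 3. [Moore1966]
* A. Weil, *Sur les "formules explicites" de la théorie des nombres premiers* (1952), (11) pp. 261–262. [Weil1952FormulesExplicites]
-/

set_option autoImplicit false

open scoped ComplexConjugate

namespace Summit.Ventures.WeilGRH

open Literature.NumberTheory.LFunctions Literature.NumberTheory.LFunctions.Yoshida1992
open Literature.NumberTheory.LFunctions.Yoshida1992.Encl

namespace UniformFloor

set_option maxHeartbeats 0 in
set_option maxRecDepth 200000 in
/-- kernel: the `16`-mode Galerkin witness for `χ₀` mod `211` at `(log 11)/2` (prime powers `< 11`; signs `ε = [1, 1, 1, 1, 1, 1, 1]`; even integer coefficients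
`c_0 … c_16` at scale `10⁷`; kernel `decide`, ≈ 150 s at `K = 28`, less for smaller `K`). [cite: Moore1966, Ch. 3 (interval arithmetic: inclusion property)] -/
theorem galerkinCheck_log11half_211 :
    galerkinCheckHalfLog ⟨2 ^ 80, 64, 8, 16, 40⟩ 70 11 211 16 [⟨2, 1⟩, ⟨3, 1⟩, ⟨2, 2⟩, ⟨5, 1⟩, ⟨7, 1⟩, ⟨2, 3⟩, ⟨3, 2⟩] [1, 1, 1, 1, 1, 1, 1]
      [9984083, -273312, 7351, 49960, -85384, 196994, 28474, 37515, -54448, 120833,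
      7178, 87227, -18134, -27308, -73903, 40217, -9951] = some true := by
  decide +kernel

/-- ★★ **The principal character mod `211` FAILS Weil positivity on `[-(log 11)/2, (log 11)/2]`.**
[cite: Yoshida1992HermitianForms, §5 (5.15)-(5.16) p. 301; Weil1952FormulesExplicites, (11) pp. 261–262] -/
theorem not_weilPositivityOnChar_log11half_principal_mod_211 :
    ¬ WeilPositivityOnChar (1 : DirichletCharacter ℂ 211) (Real.log 11 / 2) := by
  have hks : checkPrimeDataHalfLog 11 [⟨2, 1⟩, ⟨3, 1⟩, ⟨2, 2⟩, ⟨5, 1⟩, ⟨7, 1⟩, ⟨2, 3⟩, ⟨3, 2⟩] = true := by decide +kernel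
  refine not_weilPositivityOnChar_halfLog_of_galerkinCheck (prm := ⟨2 ^ 80, 64, 8, 16, 40⟩) (by norm_num) (by norm_num)
    (by norm_num) hks galerkinCheck_log11half_211 (by norm_num) 1 (fun n ↦ conj_one_apply _) charParity_one ?_
  intro i hi
  have hi' : i < 7 := by simpa using hi
  interval_cases i
  · show ((1 : DirichletCharacter ℂ 211) ((2 ^ 1 : ℕ) : ZMod 211)).re = (((1 : ℤ) : ℤ) : ℝ)
    rw [pow_one, re_one_apply_natCast, if_pos (by decide)]
    simp
  · show ((1 : DirichletCharacter ℂ 211) ((3 ^ 1 : ℕ) : ZMod 211)).re = (((1 : ℤ) : ℤ) : ℝ)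
    rw [pow_one, re_one_apply_natCast, if_pos (by decide)]
    simp
  · show ((1 : DirichletCharacter ℂ 211) ((2 ^ 2 : ℕ) : ZMod 211)).re = (((1 : ℤ) : ℤ) : ℝ)
    rw [show (2 ^ 2 : ℕ) = 4 from rfl, re_one_apply_natCast, if_pos (by decide)]
    simp
  · show ((1 : DirichletCharacter ℂ 211) ((5 ^ 1 : ℕ) : ZMod 211)).re = (((1 : ℤ) : ℤ) : ℝ)
    rw [pow_one, re_one_apply_natCast, if_pos (by decide)]
    simp
  · show ((1 : DirichletCharacter ℂ 211) ((7 ^ 1 : ℕ) : ZMod 211)).re = (((1 : ℤ) : ℤ) : ℝ)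
    rw [pow_one, re_one_apply_natCast, if_pos (by decide)]
    simp
  · show ((1 : DirichletCharacter ℂ 211) ((2 ^ 3 : ℕ) : ZMod 211)).re = (((1 : ℤ) : ℤ) : ℝ)
    rw [show (2 ^ 3 : ℕ) = 8 from rfl, re_one_apply_natCast, if_pos (by decide)]
    simp
  · show ((1 : DirichletCharacter ℂ 211) ((3 ^ 2 : ℕ) : ZMod 211)).re = (((1 : ℤ) : ℤ) : ℝ)
    rw [show (3 ^ 2 : ℕ) = 9 from rfl, re_one_apply_natCast, if_pos (by decide)]
    simp

/-- **So the all-characters statement at `(log 11)/2` fails at `q = 211`.** [cite: Weil1952FormulesExplicites, (11) pp. 261–262] -/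
theorem exists_not_weilPositivityOnChar_log11half_mod_211 :
    ∃ χ : DirichletCharacter ℂ 211, ¬ WeilPositivityOnChar χ (Real.log 11 / 2) :=
  ⟨1, not_weilPositivityOnChar_log11half_principal_mod_211⟩

end UniformFloor

end Summit.Ventures.WeilGRH
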